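import Mathlib
import Summits.NavierStokesRegularity.NavierStokesRegularity.Theorems.LerayQuarterDissipationFiniteDissipationLiouvilleThresholdKSlack
import Summits.NavierStokesRegularity.NavierStokesRegularity.Theorems.LerayQuarterDissipationFiniteDissipationLiouvilleThresholdKDefect
import Summits.NavierStokesRegularity.NavierStokesRegularity.Theorems.LerayQuarterDissipationFiniteDissipationLiouvilleThresholdLimit
import HarnessLib

/-!
# The dissipation threshold of the finite-dissipation stratum, file 5: AT `θ(K)⁴ ≤ 64/27` THE
  EQUALITY CASE OF HÖLDER IS ATTAINED ON A SINGULAR LIMIT — whose vorticity modulus is two-valued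
  (route `LerayQuarterDissipation`, crux `FiniteDissipationLiouville` stmt-NavierStokesRegularity-22144;
  lead prover g14, helper — `K`-direction analogue of `…ThresholdLimit`)

HONEST FRAMING. A statement about a HYPOTHETICAL object (a singular Type-I ancient mild field in the
KNSS gauge with the quarter-rate dissipation law at or below the dissipation threshold); file 6 shows
no such object exists. Nothing here bears on Navier–Stokes regularity or blow-up; no summit is proved.

CONTENTS. `exists_singular_limit_twoValued`: if `W ∈ 𝒟_{C,K}` (`K > 0`, `θ(K)⁴ ≤ 64/27`) is singular
at the apex, then some SINGULAR `V ∈ 𝒟_{C,K}` — a KNSS limit of rescalings of `W` — has a slice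
`t = −1` whose vorticity modulus is two-valued in the normalised form
`‖Ω(y)‖²(γ − (1−γ)‖Ω(y)‖²)² = 0` for all `y`, some `γ ∈ [0,1]`. Proof: the Hölder defect is small at
some time on every cutoff (`exists_hoelderDefect_lt`); rescale those times to `t = −1`
(`nsRescale`, scale invariance of the class, the law and the singular clause); the defect controls
the two-valuedness functional `∫‖g‖²(γ_n − (1−γ_n)‖g‖²)²` (`integral_twoValued_le_defect`, with the
class-uniform bounds `‖Ω‖ ≤ κK₁`, `∫‖Ω‖² ≤ ‖curlCLM‖²K`); KNSS compactness (`Compactness.seqLimit`),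
a further subsequence with `γ_n → γ`, and dominated convergence on every cutoff.
[cite: KochNadirashviliSereginSverak2009, §4 (arXiv:0709.3599 p. 8)]
-/

noncomputable section

set_option linter.dupNamespace false

namespace Summit.NavierStokesRegularity.NavierStokesRegularity.Theorems.FiniteDissipationLiouville.ThresholdK

open MeasureTheory Set Filter Topology Metric Function Real
open scoped ContDiff
open Literature.Analysis Literature.Analysis.FluidPDE
open Summit.NavierStokesRegularity.NavierStokesRegularity.Theorems
open Summit.NavierStokesRegularity.NavierStokesRegularity.Theorems.GaussianGap
open Summit.NavierStokesRegularity.NavierStokesRegularity.Theorems.SimilarityEnstrophy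
open Summit.NavierStokesRegularity.NavierStokesRegularity.Theorems.SmallDissipationGap
open Summit.NavierStokesRegularity.NavierStokesRegularity.Theorems.FiniteDissipationLiouville

/-- **A level `γ ∈ [0,1]` for every continuous field and cutoff.** For `f` continuous and `R > 0`,
with `g = φ_R f`: there is `γ ∈ [0,1]` (the normalised level of `integral_twoValued_le_defect`) with
`∫‖g‖²(γ − (1−γ)‖g‖²)² ≤ 2X(X − √∫‖g‖⁴)`, `X = (√∫‖g‖² · √∫‖g‖⁶)^{1/2}`. [folklore] -/
theorem exists_level_integral_le {f : EuclideanSpace ℝ (Fin 3) → EuclideanSpace ℝ (Fin 3)}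
    (hf : Continuous f) {R : ℝ} (hR : 0 < R) :
    ∃ γ ∈ Icc (0 : ℝ) 1,
      ∫ y, ‖smoothTransition (2 - ‖y‖ ^ 2 / R ^ 2) • f y‖ ^ 2 *
          (γ - (1 - γ) * ‖smoothTransition (2 - ‖y‖ ^ 2 / R ^ 2) • f y‖ ^ 2) ^ 2 ≤
        2 * Real.sqrt (Real.sqrt (∫ z, ‖smoothTransition (2 - ‖z‖ ^ 2 / R ^ 2) • f z‖ ^ 2) *
              Real.sqrt (∫ z, ‖smoothTransition (2 - ‖z‖ ^ 2 / R ^ 2) • f z‖ ^ 6)) *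
          (Real.sqrt (Real.sqrt (∫ z, ‖smoothTransition (2 - ‖z‖ ^ 2 / R ^ 2) • f z‖ ^ 2) *
              Real.sqrt (∫ z, ‖smoothTransition (2 - ‖z‖ ^ 2 / R ^ 2) • f z‖ ^ 6)) -
            Real.sqrt (∫ z, ‖smoothTransition (2 - ‖z‖ ^ 2 / R ^ 2) • f z‖ ^ 4)) := by
  set g : EuclideanSpace ℝ (Fin 3) → EuclideanSpace ℝ (Fin 3) := fun y =>
    smoothTransition (2 - ‖y‖ ^ 2 / R ^ 2) • f y with hg
  have hgc : Continuous g :=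
    (contDiff_smoothTransition_cutoff (n := 1) R).continuous.smul hf
  have hgcs : HasCompactSupport g := by
    refine HasCompactSupport.intro (isCompact_closedBall (0 : EuclideanSpace ℝ (Fin 3)) (2 * R))
      fun y hy => ?_
    show smoothTransition (2 - ‖y‖ ^ 2 / R ^ 2) • f y = 0
    rw [smoothTransition_cutoff_eq_zero_of_notMem hR hy, zero_smul]
  set r : ℝ := Real.sqrt (∫ z, ‖g z‖ ^ 6) / Real.sqrt (∫ z, ‖g z‖ ^ 2) with hr
  have hr0 : 0 ≤ r := div_nonneg (Real.sqrt_nonneg _) (Real.sqrt_nonneg _)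
  refine ⟨r / (1 + r), ⟨div_nonneg hr0 (by linarith), div_le_one_of_le₀ (by linarith) (by linarith)⟩, ?_⟩
  exact integral_twoValued_le_defect hgc hgcs

set_option maxHeartbeats 400000 in
/-- **AT THE DISSIPATION THRESHOLD THE EQUALITY CASE OF HÖLDER IS ATTAINED ON A SINGULAR LIMIT.** Let
`W ∈ 𝒟_{C,K}`, `K > 0`, `(√(max K 0)(√K_S)³)⁴ ≤ 64/27`, be singular at the apex. Then there is a
SINGULAR `V ∈ 𝒟_{C,K}` and a level `γ ∈ [0,1]` with
`‖curl V(−1,y)‖²·(γ − (1−γ)‖curl V(−1,y)‖²)² = 0` for every `y`.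
[cite: KochNadirashviliSereginSverak2009, §4 (arXiv:0709.3599 p. 8)] -/
theorem exists_singular_limit_twoValued {C K : ℝ} (hK : 0 < K)
    {W : ℝ → EuclideanSpace ℝ (Fin 3) → EuclideanSpace ℝ (Fin 3)} (hW : IsTypeIAncientMild C W)
    (hlaw : ∀ s : ℝ, s < 0 → ∫⁻ x, ‖fderiv ℝ (W s) x‖ₑ ^ 2 ≤ ENNReal.ofReal (K / Real.sqrt (-s)))
    (hθ : (Real.sqrt (max K 0) *
      Real.sqrt (SNormLESNormFDerivOfEqConst (EuclideanSpace ℝ (Fin 3))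
        (volume : Measure (EuclideanSpace ℝ (Fin 3))) 2 : ℝ) ^ 3) ^ 4 ≤ 64 / 27)
    (hsing : ∀ r > 0, ∀ M : ℝ, ∃ t ∈ Ioo (-(r ^ 2)) (0 : ℝ),
      ∃ x ∈ ball (0 : EuclideanSpace ℝ (Fin 3)) r, M < ‖W t x‖) :
    ∃ V : ℝ → EuclideanSpace ℝ (Fin 3) → EuclideanSpace ℝ (Fin 3), IsTypeIAncientMild C V ∧
      (∀ s : ℝ, s < 0 → ∫⁻ x, ‖fderiv ℝ (V s) x‖ₑ ^ 2 ≤ ENNReal.ofReal (K / Real.sqrt (-s))) ∧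
      (∀ r > 0, ∀ M : ℝ, ∃ t ∈ Ioo (-(r ^ 2)) (0 : ℝ),
        ∃ x ∈ ball (0 : EuclideanSpace ℝ (Fin 3)) r, M < ‖V t x‖) ∧
      ∃ γ ∈ Icc (0 : ℝ) 1, ∀ y,
        ‖curl (V (-1)) y‖ ^ 2 * (γ - (1 - γ) * ‖curl (V (-1)) y‖ ^ 2) ^ 2 = 0 := by
  have hKU : 0 < Real.sqrt (max K 0) := Real.sqrt_pos.2 (by rw [lt_max_iff]; exact Or.inl hK)
  -- ### times with small Hölder defect on growing cutoffs
  obtain ⟨L, M, hL0, hM0, hdef⟩ := exists_hoelderDefect_lt hW hlaw hθ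
  have hsn : ∀ n : ℕ, ∃ s : ℝ,
      2 * Real.sqrt (max K 0) *
          (Real.sqrt (Real.sqrt (∫ y, ‖smoothTransition (2 - ‖y‖ ^ 2 / ((n : ℝ) + 1) ^ 2) •
                lerayVorticity W s y‖ ^ 2) *
              Real.sqrt (∫ y, ‖smoothTransition (2 - ‖y‖ ^ 2 / ((n : ℝ) + 1) ^ 2) •
                lerayVorticity W s y‖ ^ 6)) -
            Real.sqrt (∫ y, ‖smoothTransition (2 - ‖y‖ ^ 2 / ((n : ℝ) + 1) ^ 2) •
                lerayVorticity W s y‖ ^ 4)) <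
        (2 * L * M + 1) / ((n : ℝ) + 1) := by
    intro n
    have hn1 : (1 : ℝ) ≤ (n : ℝ) + 1 := by
      have : (0 : ℝ) ≤ n := n.cast_nonneg
      linarith
    obtain ⟨s, hs⟩ := hdef ((n : ℝ) + 1) hn1 (1 / ((n : ℝ) + 1)) (by positivity)
    refine ⟨s, hs.trans_le (le_of_eq ?_)⟩
    field_simp
  choose sn hsn using hsn
  -- ### the rescaled members
  set v : ℕ → ℝ → EuclideanSpace ℝ (Fin 3) → EuclideanSpace ℝ (Fin 3) := fun n =>
    nsRescale (Real.exp (-(sn n) / 2)) W with hvdef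
  have hμ : ∀ n, 0 < Real.exp (-(sn n) / 2) := fun n => Real.exp_pos _
  have hv : ∀ n, IsTypeIAncientMild C (v n) := fun n => hW.nsRescale (hμ n)
  have hvlaw : ∀ n, ∀ s : ℝ, s < 0 →
      ∫⁻ x, ‖fderiv ℝ (v n s) x‖ₑ ^ 2 ≤ ENNReal.ofReal (K / Real.sqrt (-s)) := fun n =>
    RecurrentReductionD.dissipationLaw_nsRescale hlaw (hμ n)
  have hvsing : ∀ n, ∀ r > 0, ∀ M : ℝ, ∃ t ∈ Ioo (-(r ^ 2)) (0 : ℝ),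
      ∃ x ∈ ball (0 : EuclideanSpace ℝ (Fin 3)) r, M < ‖v n t x‖ := fun n =>
    RecurrentReductionD.singularAtOrigin_nsRescale hsing (hμ n)
  -- the vorticity of `v n` at `t = -1` is the similarity vorticity of `W` at time `sn n`
  have hΩeq : ∀ n, curl (v n (-1)) = lerayVorticity W (sn n) := by
    intro n
    have hs : (0 : ℝ) - 2 * Real.log (Real.exp (-(sn n) / 2)) = sn n := by rw [Real.log_exp]; ring
    rw [lerayVorticity_apply, ← ThresholdOne.lerayOrbit_zero (v n), hvdef, lerayOrbit_nsRescale (hμ n), hs]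
  -- ### class-uniform bounds at `t = -1`
  obtain ⟨K₁, hK₁0, hK₁⟩ := ThresholdOne.exists_norm_iteratedFDeriv_slice_le C 1
  set κ : ℝ := ‖curlCLM‖ with hκdef
  have hκ0 : 0 ≤ κ := by rw [hκdef]; exact norm_nonneg curlCLM
  set c : ℝ := κ * K₁ with hcdef
  have hc0 : 0 ≤ c := mul_nonneg hκ0 hK₁0
  have hΩb : ∀ {f : ℝ → EuclideanSpace ℝ (Fin 3) → EuclideanSpace ℝ (Fin 3)}, IsTypeIAncientMild C f →
      ∀ y, ‖curl (f (-1)) y‖ ≤ c := by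
    intro f hf y
    calc ‖curl (f (-1)) y‖ ≤ κ * ‖fderiv ℝ (f (-1)) y‖ := norm_curl_le _ _
      _ ≤ κ * K₁ := by
        rw [← norm_iteratedFDeriv_one]
        exact mul_le_mul_of_nonneg_left (hK₁ hf y) hκ0
  have hΩc : ∀ {f : ℝ → EuclideanSpace ℝ (Fin 3) → EuclideanSpace ℝ (Fin 3)}, IsTypeIAncientMild C f →
      Continuous (curl (f (-1))) := by
    intro f hf
    have h2 : ContDiff ℝ 2 (f (-1)) := (hf.contDiff_slice (by norm_num)).of_le (by norm_cast)
    have hc1 : ContDiff ℝ 1 (curl (f (-1))) := contDiff_curl (h2.of_le (by norm_cast))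
    exact hc1.continuous
  -- the enstrophy bound `∫‖curl v_n(-1)‖² ≤ M₀`
  set M₀ : ℝ := ‖curlCLM‖ ^ 2 * max K 0 with hM₀
  have hM₀0 : 0 ≤ M₀ := by positivity
  have hΩint : ∀ n, Integrable (fun y => ‖curl (v n (-1)) y‖ ^ 2) ∧
      ∫ y, ‖curl (v n (-1)) y‖ ^ 2 ≤ M₀ := by
    intro n
    have h := integrable_sq_norm_lerayVorticity (hv n) (hvlaw n) 0
    rw [lerayVorticity_apply, ThresholdOne.lerayOrbit_zero] at h
    exact h
  -- ### the levels `γ_n` and the two-valuedness functionals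
  have hlev := fun n => exists_level_integral_le (hΩc (hv n)) (R := (n : ℝ) + 1) (by positivity)
  choose γn hγn hGn using hlev
  -- the two-valuedness functional of `v n` on the cutoff `n + 1` is `≤ β n → 0`
  set Xb : ℝ := Real.sqrt (Real.sqrt M₀ * Real.sqrt (c ^ 4 * M₀)) with hXb
  have hXb0 : 0 ≤ Xb := Real.sqrt_nonneg _
  set Cβ : ℝ := 2 * Xb * ((2 * L * M + 1) / (2 * Real.sqrt (max K 0))) with hCβ
  set β : ℕ → ℝ := fun n => Cβ * (1 / ((n : ℝ) + 1)) with hβ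
  have hβ0 : Tendsto β atTop (𝓝 0) := by
    have h := (tendsto_one_div_add_atTop_nhds_zero_nat).const_mul Cβ
    rw [mul_zero] at h
    exact h
  have hGβ : ∀ n : ℕ, ∫ y, ‖smoothTransition (2 - ‖y‖ ^ 2 / ((n : ℝ) + 1) ^ 2) • curl (v n (-1)) y‖ ^ 2 *
      (γn n - (1 - γn n) * ‖smoothTransition (2 - ‖y‖ ^ 2 / ((n : ℝ) + 1) ^ 2) • curl (v n (-1)) y‖ ^ 2) ^ 2
      ≤ β n := by
    intro n
    have hR : (0 : ℝ) < (n : ℝ) + 1 := by positivity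
    set φ : EuclideanSpace ℝ (Fin 3) → ℝ := fun y => smoothTransition (2 - ‖y‖ ^ 2 / ((n : ℝ) + 1) ^ 2)
      with hφdef
    set Ω := curl (v n (-1)) with hΩdef
    have hφ0 : ∀ y, 0 ≤ φ y := fun y => smoothTransition_cutoff_nonneg ((n : ℝ) + 1) y
    have hφ1 : ∀ y, φ y ≤ 1 := fun y => smoothTransition.le_one _
    have hΩcn : Continuous Ω := hΩc (hv n)
    have hgc : Continuous fun y => φ y • Ω y :=
      (contDiff_smoothTransition_cutoff (n := 1) ((n : ℝ) + 1)).continuous.smul hΩcn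
    have hgcs : HasCompactSupport fun y => φ y • Ω y := by
      refine HasCompactSupport.intro (isCompact_closedBall (0 : EuclideanSpace ℝ (Fin 3)) (2 * ((n : ℝ) + 1)))
        fun y hy => ?_
      show φ y • Ω y = 0
      rw [hφdef]
      dsimp only
      rw [smoothTransition_cutoff_eq_zero_of_notMem hR hy, zero_smul]
    -- the norms of `g = φ Ω`
    set A : ℝ := ∫ z, ‖φ z • Ω z‖ ^ 2 with hA
    set I4 : ℝ := ∫ z, ‖φ z • Ω z‖ ^ 4 with hI4
    set I6 : ℝ := ∫ z, ‖φ z • Ω z‖ ^ 6 with hI6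
    have hng : ∀ z, ‖φ z • Ω z‖ ≤ ‖Ω z‖ := fun z => by
      rw [norm_smul, Real.norm_of_nonneg (hφ0 z)]
      exact mul_le_of_le_one_left (norm_nonneg _) (hφ1 z)
    have hngc : ∀ z, ‖φ z • Ω z‖ ≤ c := fun z => (hng z).trans (hΩb (hv n) z)
    have hint : ∀ k : ℕ, k ≠ 0 → Integrable (fun z => ‖φ z • Ω z‖ ^ k) := fun k hk =>
      (hgc.norm.pow k).integrable_of_hasCompactSupport
        (hgcs.norm.mono fun y hy => by
          rw [Function.mem_support] at hy ⊢
          intro h0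
          exact hy (by simp only [Pi.pow_apply]; rw [h0, zero_pow hk]))
    have hA0 : 0 ≤ A := integral_nonneg fun z => by positivity
    have hI60 : 0 ≤ I6 := integral_nonneg fun z => by positivity
    have hAM : A ≤ M₀ := by
      refine ((integral_mono (hint 2 (by norm_num)) (hΩint n).1 fun z => ?_)).trans (hΩint n).2
      exact pow_le_pow_left₀ (norm_nonneg _) (hng z) 2
    have hI6A : I6 ≤ c ^ 4 * M₀ := by
      have h1 : I6 ≤ ∫ z, c ^ 4 * ‖φ z • Ω z‖ ^ 2 := by
        refine integral_mono (hint 6 (by norm_num)) ((hint 2 (by norm_num)).const_mul _) fun z => ?_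
        show ‖φ z • Ω z‖ ^ 6 ≤ c ^ 4 * ‖φ z • Ω z‖ ^ 2
        have h := pow_le_pow_left₀ (norm_nonneg _) (hngc z) 4
        nlinarith [sq_nonneg ‖φ z • Ω z‖]
      rw [integral_const_mul] at h1
      exact h1.trans (mul_le_mul_of_nonneg_left hAM (by positivity))
    have hX : Real.sqrt (Real.sqrt A * Real.sqrt I6) ≤ Xb := by
      rw [hXb]
      exact Real.sqrt_le_sqrt (mul_le_mul (Real.sqrt_le_sqrt hAM) (Real.sqrt_le_sqrt hI6A)
        (Real.sqrt_nonneg _) (Real.sqrt_nonneg _))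
    have hX0 : 0 ≤ Real.sqrt (Real.sqrt A * Real.sqrt I6) := Real.sqrt_nonneg _
    -- Hölder: the defect is non-negative
    have hH : I4 ≤ Real.sqrt A * Real.sqrt I6 := integral_norm_pow_four_le_sqrt_mul_sqrt hgc hgcs
    have hd0 : 0 ≤ Real.sqrt (Real.sqrt A * Real.sqrt I6) - Real.sqrt I4 :=
      sub_nonneg.2 (Real.sqrt_le_sqrt hH)
    -- the defect bound at time `sn n`, transported to `v n`
    have hdn : 2 * Real.sqrt (max K 0) * (Real.sqrt (Real.sqrt A * Real.sqrt I6) - Real.sqrt I4) <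
        (2 * L * M + 1) / ((n : ℝ) + 1) := by
      have h := hsn n
      rw [← hΩeq n] at h
      exact h
    have hdn' : Real.sqrt (Real.sqrt A * Real.sqrt I6) - Real.sqrt I4 ≤
        (2 * L * M + 1) / ((n : ℝ) + 1) / (2 * Real.sqrt (max K 0)) := by
      rw [le_div_iff₀ (by positivity)]
      linarith
    calc ∫ y, ‖φ y • Ω y‖ ^ 2 * (γn n - (1 - γn n) * ‖φ y • Ω y‖ ^ 2) ^ 2
        ≤ 2 * Real.sqrt (Real.sqrt A * Real.sqrt I6) *
            (Real.sqrt (Real.sqrt A * Real.sqrt I6) - Real.sqrt I4) := hGn n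
      _ ≤ 2 * Xb * ((2 * L * M + 1) / ((n : ℝ) + 1) / (2 * Real.sqrt (max K 0))) :=
          mul_le_mul (mul_le_mul_of_nonneg_left hX (by norm_num)) hdn' hd0 (by positivity)
      _ = β n := by
          rw [hβ, hCβ]
          dsimp only
          field_simp
  -- ### compactness across members, then a further subsequence along which `γ_n` converges
  obtain ⟨ψ, hψ, V, hV, hunif, hpt, hgrad⟩ := Compactness.seqLimit hv
  have hψt : Tendsto ψ atTop atTop := hψ.tendsto_atTop
  have hVlaw : ∀ s : ℝ, s < 0 →
      ∫⁻ x, ‖fderiv ℝ (V s) x‖ₑ ^ 2 ≤ ENNReal.ofReal (K / Real.sqrt (-s)) :=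
    Compactness.law_of_seqLimit (Kk := fun _ => K) (Kinf := K) hψt hvlaw
      (fun ε hε => Eventually.of_forall fun k => by linarith) hgrad
  have hVsing := Compactness.persistent_singularity_seq (w := fun j => v (ψ j))
    (fun j => hv _) (fun j => hvlaw _) (fun j => hvsing _) hV hunif
  obtain ⟨γ, hγmem, φ₂, hφ₂, hγlim⟩ := tendsto_subseq_of_bounded (isBounded_Icc (0 : ℝ) 1)
    (fun j => hγn (ψ j))
  rw [closure_Icc] at hγmem
  refine ⟨V, hV, hVlaw, hVsing, γ, hγmem, ?_⟩
  have hφ₂t : Tendsto φ₂ atTop atTop := hφ₂.tendsto_atTop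
  have hidx : Tendsto (fun j => ψ (φ₂ j)) atTop atTop := hψt.comp hφ₂t
  -- ### the two-valuedness functional of the limit vanishes on every cutoff
  intro y
  set Ω : EuclideanSpace ℝ (Fin 3) → EuclideanSpace ℝ (Fin 3) := curl (V (-1)) with hΩdef
  have hΩcV : Continuous Ω := hΩc hV
  set G : EuclideanSpace ℝ (Fin 3) → ℝ := fun z => ‖Ω z‖ ^ 2 * (γ - (1 - γ) * ‖Ω z‖ ^ 2) ^ 2 with hGdef
  have hGc : Continuous G := (hΩcV.norm.pow 2).mul ((continuous_const.sub
    (continuous_const.mul (hΩcV.norm.pow 2))).pow 2)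
  have hG0 : ∀ z, 0 ≤ G z := fun z => mul_nonneg (sq_nonneg _) (sq_nonneg _)
  set ρ : ℝ := max 1 ‖y‖ with hρdef
  have hρ : 0 < ρ := lt_of_lt_of_le one_pos (le_max_left _ _)
  set χ : EuclideanSpace ℝ (Fin 3) → ℝ := fun z => smoothTransition (2 - ‖z‖ ^ 2 / ρ ^ 2) with hχdef
  have hχc : Continuous χ := (contDiff_smoothTransition_cutoff (n := 1) ρ).continuous
  have hχcs : HasCompactSupport χ := hasCompactSupport_smoothTransition_cutoff hρ
  have hχ0 : ∀ z, 0 ≤ χ z := fun z => smoothTransition_cutoff_nonneg ρ z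
  have hχ1 : ∀ z, χ z ≤ 1 := fun z => smoothTransition.le_one _
  have hχz : ∀ z ∉ closedBall (0 : EuclideanSpace ℝ (Fin 3)) (2 * ρ), χ z = 0 := fun z hz =>
    smoothTransition_cutoff_eq_zero_of_notMem hρ hz
  -- the integrands along the sub-subsequence (no inner cutoff) and their limit
  set F : ℕ → EuclideanSpace ℝ (Fin 3) → ℝ := fun j z =>
    χ z * (‖curl (v (ψ (φ₂ j)) (-1)) z‖ ^ 2 *
      (γn (ψ (φ₂ j)) - (1 - γn (ψ (φ₂ j))) * ‖curl (v (ψ (φ₂ j)) (-1)) z‖ ^ 2) ^ 2) with hFdef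
  have hFc : ∀ j, Continuous (F j) := fun j => by
    have h := hΩc (hv (ψ (φ₂ j)))
    exact hχc.mul ((h.norm.pow 2).mul ((continuous_const.sub (continuous_const.mul (h.norm.pow 2))).pow 2))
  have hkey : Tendsto (fun j => ∫ z, F j z) atTop (𝓝 (∫ z, χ z * G z)) := by
    refine tendsto_integral_of_dominated_convergence (fun z => χ z * (c ^ 2 * (1 + c ^ 2) ^ 2))
      (fun j => (hFc j).aestronglyMeasurable)
      ((hχc.mul continuous_const).integrable_of_hasCompactSupport hχcs.mul_right)
      (fun j => Eventually.of_forall fun z => ?_) (Eventually.of_forall fun z => ?_)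
    · -- domination: `‖Ω_n‖ ≤ c`, `γ_n ∈ [0,1]`
      rw [hFdef]
      dsimp only
      set w : ℝ := ‖curl (v (ψ (φ₂ j)) (-1)) z‖ ^ 2 with hw
      have hw0 : 0 ≤ w := sq_nonneg _
      have hwc : w ≤ c ^ 2 := by
        rw [hw]; exact pow_le_pow_left₀ (norm_nonneg _) (hΩb (hv _) z) 2
      obtain ⟨hg0, hg1⟩ := hγn (ψ (φ₂ j))
      have hin : |γn (ψ (φ₂ j)) - (1 - γn (ψ (φ₂ j))) * w| ≤ 1 + c ^ 2 := by
        rw [abs_le]; constructor <;> nlinarith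
      have hsq : (γn (ψ (φ₂ j)) - (1 - γn (ψ (φ₂ j))) * w) ^ 2 ≤ (1 + c ^ 2) ^ 2 := by
        rw [← sq_abs]
        exact pow_le_pow_left₀ (abs_nonneg _) hin 2
      rw [Real.norm_eq_abs, abs_of_nonneg (mul_nonneg (hχ0 z) (mul_nonneg hw0 (sq_nonneg _)))]
      exact mul_le_mul_of_nonneg_left (mul_le_mul hwc hsq (sq_nonneg _) (by positivity)) (hχ0 z)
    · -- pointwise convergence
      have hΩz : Tendsto (fun j => curl (v (ψ (φ₂ j)) (-1)) z) atTop (𝓝 (Ω z)) := by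
        have h1 : Tendsto (fun j => fderiv ℝ (v (ψ (φ₂ j)) (-1)) z) atTop (𝓝 (fderiv ℝ (V (-1)) z)) :=
          (hgrad (-1) (by norm_num) z).comp hφ₂t
        rw [hΩdef]
        simp only [curl_eq_curlCLM]
        exact (curlCLM.continuous.tendsto _).comp h1
      have hw := (hΩz.norm).pow 2
      exact tendsto_const_nhds.mul (hw.mul ((hγlim.sub ((tendsto_const_nhds.sub hγlim).mul hw)).pow 2))
  -- the integrals along the sub-subsequence are `≤ β → 0` eventually
  have hev : ∀ᶠ j in atTop, 2 * ρ ≤ ((ψ (φ₂ j) : ℕ) : ℝ) + 1 := by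
    have h1 : Tendsto (fun j => ((ψ (φ₂ j) : ℕ) : ℝ) + 1) atTop atTop :=
      tendsto_atTop_add_const_right _ 1 (tendsto_natCast_atTop_atTop.comp hidx)
    exact h1.eventually_ge_atTop (2 * ρ)
  have hle : ∀ᶠ j in atTop, ∫ z, F j z ≤ β (ψ (φ₂ j)) := by
    filter_upwards [hev] with j hj
    set n := ψ (φ₂ j) with hn
    have hR : (0 : ℝ) < (n : ℝ) + 1 := by positivity
    refine le_trans (integral_mono_of_nonneg (Eventually.of_forall fun z => ?_) ?_
      (Eventually.of_forall fun z => ?_)) (hGβ n)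
    · -- `0 ≤ F j`
      show 0 ≤ F j z
      rw [hFdef]
      exact mul_nonneg (hχ0 z) (mul_nonneg (sq_nonneg _) (sq_nonneg _))
    · -- integrability of the cutoff functional
      have h := hΩc (hv n)
      have hgc : Continuous fun z => smoothTransition (2 - ‖z‖ ^ 2 / ((n : ℝ) + 1) ^ 2) • curl (v n (-1)) z :=
        (contDiff_smoothTransition_cutoff (n := 1) ((n : ℝ) + 1)).continuous.smul h
      refine ((hgc.norm.pow 2).mul ((continuous_const.sub
        (continuous_const.mul (hgc.norm.pow 2))).pow 2)).integrable_of_hasCompactSupport ?_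
      refine HasCompactSupport.intro (isCompact_closedBall (0 : EuclideanSpace ℝ (Fin 3)) (2 * ((n : ℝ) + 1)))
        fun z hz => ?_
      show ‖smoothTransition (2 - ‖z‖ ^ 2 / ((n : ℝ) + 1) ^ 2) • curl (v n (-1)) z‖ ^ 2 *
        (γn n - (1 - γn n) * ‖smoothTransition (2 - ‖z‖ ^ 2 / ((n : ℝ) + 1) ^ 2) • curl (v n (-1)) z‖ ^ 2) ^ 2 = 0
      rw [smoothTransition_cutoff_eq_zero_of_notMem hR hz, zero_smul, norm_zero]
      ring
    · -- pointwise comparison `F j ≤` cutoff functional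
      show F j z ≤ ‖smoothTransition (2 - ‖z‖ ^ 2 / ((n : ℝ) + 1) ^ 2) • curl (v n (-1)) z‖ ^ 2 *
        (γn n - (1 - γn n) * ‖smoothTransition (2 - ‖z‖ ^ 2 / ((n : ℝ) + 1) ^ 2) • curl (v n (-1)) z‖ ^ 2) ^ 2
      rw [hFdef]
      dsimp only
      rw [← hn]
      by_cases hz : ‖z‖ ≤ (n : ℝ) + 1
      · rw [smoothTransition_cutoff_eq_one hR hz, one_smul]
        have h0 : 0 ≤ ‖curl (v n (-1)) z‖ ^ 2 * (γn n - (1 - γn n) * ‖curl (v n (-1)) z‖ ^ 2) ^ 2 :=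
          mul_nonneg (sq_nonneg _) (sq_nonneg _)
        exact mul_le_of_le_one_left h0 (hχ1 z)
      · have hz' : z ∉ closedBall (0 : EuclideanSpace ℝ (Fin 3)) (2 * ρ) := by
          rw [mem_closedBall, dist_zero_right]
          push Not at hz ⊢
          linarith
        rw [hχz z hz', zero_mul]
        exact mul_nonneg (sq_nonneg _) (sq_nonneg _)
  have hβ' : Tendsto (fun j => β (ψ (φ₂ j))) atTop (𝓝 0) := hβ0.comp hidx
  have hge : ∀ j, 0 ≤ ∫ z, F j z := fun j =>
    integral_nonneg fun z => by
      rw [hFdef]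
      exact mul_nonneg (hχ0 z) (mul_nonneg (sq_nonneg _) (sq_nonneg _))
  have hI1 : ∫ z, χ z * G z ≤ 0 := le_of_tendsto_of_tendsto hkey hβ' hle
  have hI2 : 0 ≤ ∫ z, χ z * G z := ge_of_tendsto' hkey hge
  have hI0 : ∫ z, χ z * G z = 0 := le_antisymm hI1 hI2
  -- a continuous non-negative integrand with zero integral vanishes
  have hint : Integrable fun z => χ z * G z := (hχc.mul hGc).integrable_of_hasCompactSupport hχcs.mul_right
  have hae : (fun z => χ z * G z) =ᵐ[volume] 0 :=
    (integral_eq_zero_iff_of_nonneg (fun z => mul_nonneg (hχ0 z) (hG0 z)) hint).1 hI0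
  have hall : (fun z => χ z * G z) = 0 := (hχc.mul hGc).ae_eq_iff_eq volume continuous_const |>.1 hae
  have hy : χ y * G y = 0 := congrFun hall y
  have hχy : χ y = 1 := smoothTransition_cutoff_eq_one hρ (le_max_right _ _)
  rw [hχy, one_mul] at hy
  exact hy

end Summit.NavierStokesRegularity.NavierStokesRegularity.Theorems.FiniteDissipationLiouville.ThresholdK

end
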